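import Mathlib.Analysis.SpecialFunctions.Integrals.Basic
import Literature.Claims.NS.Nadirashvili2026

/-!
# C129 `Nadirashvili2026` — erratum-grade refutation of the recorded display Lemma 5.1 (5.1), print p.28

D-0090 NS-CLAIMS (cell ns-claims, row C129; N. Nadirashvili, *Navier–Stokes Equations in Complex
Space*, arXiv:2606.02811 v4, PDF page = printed page). Skeleton `Literature.Claims.NS.Nadirashvili2026`
(ns-claims-typist-7 g3, p493920 + rev 2 p494606 + rev 3 p497226). This file decides the OFF-PATH recorded
display `Step_L51` (Lemma 5.1, (5.1) p.28 [TeX 1245–1253]); it is an ERRATUM-column entry of the row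
(MAP-SCHEMA §1b), NOT the locator: the row's locator of record is `Step_subsol` (5.18) p.36, refuted by
`…Theorems.Nadirashvili2026.not_Step_subsol` p496929 (ADJUDICATED #116). 1-D integral pieces
(`integral_cosh_sq`, `key_ineq`) after ns-claims-refuter-5 g0's scratch `Lemma51-1D-pieces.lean`;
assembly ns-claims-refuter-1 g2 (second refuter, C129), 2026-08-27.

STATEMENT DECIDED. `Step_L51`: for `0 < b ≤ 1`, `0 < r ≤ 1` and every `C²` function `u` harmonic in
`A = (0, π/b) × (0, r)`, vanishing on the bottom and the two vertical sides,
`∫∫_A (u_x² + u_y²) ≤ ∫∫_A u_x² + (1/r) ∫₀^{π/b} u(x, r)² dx`, i.e. `∫∫_A u_y² ≤ (1/r)∫_a u²`.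

WITNESS. `b = r = 1`, `u(x, y) = sin x · sinh y` (harmonic, zero on `y = 0`, `x = 0`, `x = π`):
`∫₀^π∫₀¹ u_y² = (π/2)·∫₀¹ cosh² = (π/2)(1/2 + sinh 2 / 4)` while `(1/r)∫_a u² = (π/2) sinh² 1`, and
`1/2 + sinh 2/4 > sinh² 1 ⟺ 8 > e² + 3e⁻²` (`7.795… < 8`). The same factor refutes Lemma 5.2 (5.2)
p.29 on paper (not typed). Lemma 5.4 (the inequality the composition path actually uses) is TRUE.

WHAT THIS IS NOT: not a claim about NS regularity or blow-up; not a claim about any author beyond the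
typed locator.
-/

set_option linter.dupNamespace false

noncomputable section

open Real intervalIntegral Set

namespace Summit.NavierStokesRegularity.NavierStokesRegularity.Theorems.Nadirashvili2026

namespace L51

/-! ## One-dimensional integrals -/

/-- An antiderivative of `cosh²`: `d/dy (y/2 + sinh 2y/4) = cosh² y`. -/
theorem hasDerivAt_coshPrim (y : ℝ) :
    HasDerivAt (fun y : ℝ => y / 2 + sinh (2 * y) / 4) (cosh y ^ 2) y := by
  have h1 : HasDerivAt (fun y : ℝ => y / 2) (1 / 2) y := by
    simpa using (hasDerivAt_id y).div_const 2
  have h2 : HasDerivAt (fun y : ℝ => sinh (2 * y) / 4) (cosh (2 * y) * 2 / 4) y := by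
    have := ((Real.hasDerivAt_sinh (2 * y)).comp y ((hasDerivAt_id y).const_mul 2))
    simpa using this.div_const 4
  have e : cosh y ^ 2 = 1 / 2 + cosh (2 * y) * 2 / 4 := by
    rw [Real.cosh_two_mul, Real.cosh_sq]; ring
  rw [e]; exact h1.add h2

/-- An antiderivative of `sinh²`: `d/dy (sinh 2y/4 − y/2) = sinh² y`. -/
theorem hasDerivAt_sinhPrim (y : ℝ) :
    HasDerivAt (fun y : ℝ => sinh (2 * y) / 4 - y / 2) (sinh y ^ 2) y := by
  have h1 : HasDerivAt (fun y : ℝ => y / 2) (1 / 2) y := by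
    simpa using (hasDerivAt_id y).div_const 2
  have h2 : HasDerivAt (fun y : ℝ => sinh (2 * y) / 4) (cosh (2 * y) * 2 / 4) y := by
    have := ((Real.hasDerivAt_sinh (2 * y)).comp y ((hasDerivAt_id y).const_mul 2))
    simpa using this.div_const 4
  have e : sinh y ^ 2 = cosh (2 * y) * 2 / 4 - 1 / 2 := by
    rw [Real.cosh_two_mul, Real.cosh_sq]; ring
  rw [e]; exact h2.sub h1

/-- `∫₀¹ cosh² = 1/2 + sinh 2 / 4`. -/
theorem integral_cosh_sq : ∫ y in (0:ℝ)..1, cosh y ^ 2 = 1 / 2 + sinh 2 / 4 := by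
  rw [integral_eq_sub_of_hasDerivAt (fun y _ => hasDerivAt_coshPrim y)
    ((continuous_cosh.pow 2).intervalIntegrable 0 1)]
  simp

/-- `∫₀¹ sinh² = sinh 2 / 4 − 1/2`. -/
theorem integral_sinh_sq : ∫ y in (0:ℝ)..1, sinh y ^ 2 = sinh 2 / 4 - 1 / 2 := by
  rw [integral_eq_sub_of_hasDerivAt (fun y _ => hasDerivAt_sinhPrim y)
    ((continuous_sinh.pow 2).intervalIntegrable 0 1)]
  simp

/-- `∫₀^π sin² = π/2`. -/
theorem integral_sin_sq_pi : ∫ x in (0:ℝ)..π, sin x ^ 2 = π / 2 := by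
  rw [integral_sin_sq]; simp

/-- `∫₀^π cos² = π/2`. -/
theorem integral_cos_sq_pi : ∫ x in (0:ℝ)..π, cos x ^ 2 = π / 2 := by
  rw [integral_cos_sq]; simp

/-- The numeric heart: `sinh² 1 < 1/2 + sinh 2/4`, i.e. `e² + 3e⁻² < 8`. -/
theorem key_ineq : sinh 1 ^ 2 < 1 / 2 + sinh 2 / 4 := by
  have h2 : sinh (2:ℝ) = (exp 2 - exp (-2)) / 2 := Real.sinh_eq 2
  have h1 : sinh (1:ℝ) = (exp 1 - exp (-1)) / 2 := Real.sinh_eq 1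
  have e2 : exp (2:ℝ) = exp 1 ^ 2 := by rw [← Real.exp_nat_mul]; norm_num
  have em1 : exp (-1:ℝ) = (exp 1)⁻¹ := by rw [Real.exp_neg]
  have em2 : exp (-2:ℝ) = (exp 1 ^ 2)⁻¹ := by rw [Real.exp_neg, e2]
  rw [h1, h2, e2, em1, em2]
  have lo := Real.exp_one_gt_d9
  have hi := Real.exp_one_lt_d9
  have hpos : 0 < exp (1:ℝ) := exp_pos 1
  set E : ℝ := exp 1 with hEdef
  have hI0 : 0 < E⁻¹ := inv_pos.mpr hpos
  have hEI : E * E⁻¹ = 1 := mul_inv_cancel₀ hpos.ne'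
  have hinv : E⁻¹ < 37 / 100 := by
    rw [inv_lt_comm₀ hpos (by norm_num)]; linarith
  have hE2 : E ^ 2 < 739 / 100 := by nlinarith
  have hI2 : E⁻¹ ^ 2 < 14 / 100 := by nlinarith
  have hsq : (E ^ 2)⁻¹ = E⁻¹ ^ 2 := by rw [inv_pow]
  rw [hsq]
  nlinarith

/-! ## The witness `u(x, y) = sin x · sinh y` -/

/-- The witness. -/
def u (x y : ℝ) : ℝ := sin x * sinh y

/-- Unfolding of the witness. -/
theorem u_def : u = fun x y => sin x * sinh y := rfl

/-- The witness is `C²` jointly (indeed `C^∞`). -/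
theorem contDiff_u : ContDiff ℝ 2 (Function.uncurry u) := by
  have h : (Function.uncurry u) = fun p : ℝ × ℝ => sin p.1 * sinh p.2 := by
    funext p; rfl
  rw [h]
  exact (Real.contDiff_sin.comp contDiff_fst).mul (Real.contDiff_sinh.comp contDiff_snd)

/-- `u_x = cos x · sinh y`. -/
theorem deriv_u_x (y x : ℝ) : deriv (fun s => u s y) x = cos x * sinh y :=
  ((Real.hasDerivAt_sin x).mul_const (sinh y)).deriv

/-- `u_y = sin x · cosh y`. -/
theorem deriv_u_y (x y : ℝ) : deriv (u x) y = sin x * cosh y := by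
  have : HasDerivAt (u x) (sin x * cosh y) y := by
    simpa [u_def] using (Real.hasDerivAt_sinh y).const_mul (sin x)
  exact this.deriv

/-- `u_xx = −sin x · sinh y`. -/
theorem iteratedDeriv_two_u_x (y x : ℝ) : iteratedDeriv 2 (fun s => u s y) x = -(sin x * sinh y) := by
  rw [iteratedDeriv_succ, iteratedDeriv_one]
  have h1 : deriv (fun s => u s y) = fun s => cos s * sinh y := by
    funext s; exact deriv_u_x y s
  rw [h1]
  have : HasDerivAt (fun s => cos s * sinh y) (-sin x * sinh y) x :=
    (Real.hasDerivAt_cos x).mul_const (sinh y)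
  rw [this.deriv]; ring

/-- `u_yy = sin x · sinh y` (so `u` is harmonic). -/
theorem iteratedDeriv_two_u_y (x y : ℝ) : iteratedDeriv 2 (u x) y = sin x * sinh y := by
  rw [iteratedDeriv_succ, iteratedDeriv_one]
  have h1 : deriv (u x) = fun s => sin x * cosh s := by
    funext s; exact deriv_u_y x s
  rw [h1]
  exact ((Real.hasDerivAt_cosh y).const_mul (sin x)).deriv

/-! ## The three double integrals at the witness -/

/-- Inner integral of `u_x² + u_y²`. -/
theorem inner_full (x : ℝ) :
    ∫ y in (0:ℝ)..1, ((cos x * sinh y) ^ 2 + (sin x * cosh y) ^ 2) =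
      cos x ^ 2 * (sinh 2 / 4 - 1 / 2) + sin x ^ 2 * (1 / 2 + sinh 2 / 4) := by
  have hf : IntervalIntegrable (fun y => (cos x * sinh y) ^ 2) MeasureTheory.volume 0 1 :=
    ((continuous_const.mul continuous_sinh).pow 2).intervalIntegrable 0 1
  have hg : IntervalIntegrable (fun y => (sin x * cosh y) ^ 2) MeasureTheory.volume 0 1 :=
    ((continuous_const.mul continuous_cosh).pow 2).intervalIntegrable 0 1
  rw [integral_add hf hg]
  have e1 : (fun y => (cos x * sinh y) ^ 2) = fun y => cos x ^ 2 * sinh y ^ 2 := by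
    funext y; ring
  have e2 : (fun y => (sin x * cosh y) ^ 2) = fun y => sin x ^ 2 * cosh y ^ 2 := by
    funext y; ring
  rw [e1, e2, integral_const_mul, integral_const_mul, integral_sinh_sq, integral_cosh_sq]

/-- Inner integral of `u_x²`. -/
theorem inner_x (x : ℝ) :
    ∫ y in (0:ℝ)..1, (cos x * sinh y) ^ 2 = cos x ^ 2 * (sinh 2 / 4 - 1 / 2) := by
  have e1 : (fun y => (cos x * sinh y) ^ 2) = fun y => cos x ^ 2 * sinh y ^ 2 := by
    funext y; ring
  rw [e1, integral_const_mul, integral_sinh_sq]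

/-- `∫₀^π ∫₀¹ (u_x² + u_y²)` in closed form. -/
theorem outer_full :
    ∫ x in (0:ℝ)..π, (cos x ^ 2 * (sinh 2 / 4 - 1 / 2) + sin x ^ 2 * (1 / 2 + sinh 2 / 4)) =
      π / 2 * (sinh 2 / 4 - 1 / 2) + π / 2 * (1 / 2 + sinh 2 / 4) := by
  have hf : IntervalIntegrable (fun x => cos x ^ 2 * (sinh 2 / 4 - 1 / 2)) MeasureTheory.volume 0 π :=
    ((continuous_cos.pow 2).mul continuous_const).intervalIntegrable 0 π
  have hg : IntervalIntegrable (fun x => sin x ^ 2 * (1 / 2 + sinh 2 / 4)) MeasureTheory.volume 0 π :=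
    ((continuous_sin.pow 2).mul continuous_const).intervalIntegrable 0 π
  rw [integral_add hf hg, integral_mul_const, integral_mul_const, integral_cos_sq_pi,
    integral_sin_sq_pi]

/-- `∫₀^π ∫₀¹ u_x²` in closed form. -/
theorem outer_x :
    ∫ x in (0:ℝ)..π, cos x ^ 2 * (sinh 2 / 4 - 1 / 2) = π / 2 * (sinh 2 / 4 - 1 / 2) := by
  rw [integral_mul_const, integral_cos_sq_pi]

/-- The boundary term `∫₀^π u(x,1)² = (π/2) sinh² 1`. -/
theorem outer_top :
    ∫ x in (0:ℝ)..π, u x 1 ^ 2 = π / 2 * sinh 1 ^ 2 := by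
  have e1 : (fun x => u x 1 ^ 2) = fun x => sin x ^ 2 * sinh 1 ^ 2 := by
    funext x; simp only [u]; ring
  rw [e1, integral_mul_const, integral_sin_sq_pi]

end L51

open L51 in
/-- **Lemma 5.1 (5.1) p.28 of arXiv:2606.02811 v4 is false as recorded** (`Step_L51`, functions grain):
at `b = r = 1`, `u = sin x · sinh y`, the left side exceeds the right side by `(π/2)(1/2 + sinh 2/4 − sinh² 1)
> 0`. Erratum-grade (off the composition path of row C129). -/
theorem not_Step_L51 : ¬ Literature.Claims.NS.Nadirashvili2026.Step_L51 := by
  intro h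
  have H := h 1 1 u one_pos le_rfl one_pos le_rfl contDiff_u
    (fun x _ y _ => by rw [iteratedDeriv_two_u_x, iteratedDeriv_two_u_y]; ring)
    (fun x _ => by simp [u])
    (fun y _ => by simp [u])
  simp only [div_one, one_mul, deriv_u_x, deriv_u_y] at H
  rw [funext inner_full, funext inner_x, outer_full, outer_x, outer_top] at H
  have hπ : 0 < π / 2 := by positivity
  have hk := key_ineq
  nlinarith

end Summit.NavierStokesRegularity.NavierStokesRegularity.Theorems.Nadirashvili2026
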